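import Summits.ABC.ABC.Theses.IsogenyGlueCongruence
import Summits.ABC.ABC.Theorems.IsogenyGlueCongruencePolyDegreeOfBoundedPrimesHeightCalibrationExact
import Summits.ABC.ABC.Theorems.IsogenyGlueCongruencePolyDegreeOfBoundedPrimesOptimalCalibrationItems
import Summits.ABC.ABC.Theorems.IsogenyGlueCongruenceSemistableManinBound2
import Summits.ABC.ABC.Theorems.IsogenyGlueCongruenceMazurKenkuBoundEdixhoven
import Literature.NumberTheory.Automorphic.ShimuraCurveRibetTakahashiSemistableManinProofs

/-!
# Skeleton v7 — crux `PolyDegreeOfBoundedPrimes` (stmt-ABC-2046), line `Sketch`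
# (lead continuation prover-line-stmt-ABC-2046-c5-0, cycle 6, 2026-08-17)

Crux B of route IsogenyGlueCongruence: `DegreePrimesPolyBounded → P`, `P` = the polynomial modular-degree
conjecture for semistable elliptic curves over `ℚ` in the tree's `∃ D` idiom. Notation: `A` =
`DegreePrimesPolyBounded` (crux, stmt-ABC-2045), `B` = this crux `= (A → P)`, `B'` = `PolyHeightOfBoundedPrimes`
`= (A → H)` (crux, stmt-ABC-16006), `SMB2` = `SemistableManinBound2` (support, rank 9, known in print,
stmt-ABC-16014), `H` = the polynomial height conjecture for semistable curves, `M` = polynomially bounded Manin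
data (definitions below).

## v7 = v6 RESHAPED into item vocabulary after three changes in the tree (composition idea unchanged:
## "B is the height conjecture plus a Manin input")

v6 (lead c4, cycle 5; `PolyDegreeOfBoundedPrimes_of (hMK : MazurKenkuBound)`) was complete modulo three
registered stubs: `stub_polyHeight` = `H` (conjecture-grade) and the two named facts `stub_edixhovenFact` (ED,
Edixhoven 1991 Prop. 2 in lattice form) and `stub_cesnaviciusFact` (CES, Česnavičius 2018 Thm. 1.2). Since then:

1. **ED is a theorem of the tree** — `Summit.ABC.ABC.Theorems.edixhovenIntegrality_proof` /
   `edixhoven_int_of_neronLattice_eq_smul_periodLattice_of_flexLine` (MazurKenkuBound lead c19, item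
   stmt-ABC-15990 closed, 2026-08-17T01:19Z). The v6 stub `stub_edixhovenFact` is CLOSED below by `exact`, and
   lands in Theorems under its registered name (file `…PolyDegreeOfBoundedPrimesOfHeightAndManinItems`, p137484).
2. **The Manin package is an ITEM** — the planner promoted "CES + ED + Mazur–Kenku + Néron scaling, in the
   consumed form crux B's line needs" to the rank-9 known-in-print support items `SemistableManinBound` /
   `SemistableManinBound2` (stmt-ABC-16013 / 16014; rchoice 44afd190 / 8cb3b1b0: "the apex named facts enter
   that line ONLY through this consequence, which is therefore the item"). Exactly as v6 took the route item
   `MazurKenkuBound` as the hypothesis `hMK` (rchoice 194e94e5: item vocabulary, never apex names), v7 takes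
   `(hMan : SemistableManinBound2)`; CES, `hMK` and the optimal-curve detour (stubs DEG/OPT of v5) are thereby
   ABSORBED — and exactly so: granted A, `SMB2 ↔ M` (`semistableManinBound2_iff_maninData`, Carayol's theorem
   at square-free level, proved below).
3. **The residual is an ITEM** — the planner filed `A → H` as the crux B' = `PolyHeightOfBoundedPrimes`
   (stmt-ABC-16006, rank 4; live lead with its own line archimedean-hall-split, 9/11 stubs landed, stuck cores
   `stub_polySzpiroDelta` / `stub_polyHallDelta`). v7's single registered stub is therefore B' BY NAME
   (`stub_polyHeightOfBoundedPrimes : PolyHeightOfBoundedPrimes`) — weaker than v6's `H` (it may use A) and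
   literally the sibling item, so it is NOT a worker target of this line (never two seats on one statement):
   the crux is blocked-on stmt-ABC-16006.

Composition v7: `PolyDegreeOfBoundedPrimes_of (hMan : SemistableManinBound2) : PolyDegreeOfBoundedPrimes` —
given A, the stub gives `H`, the item gives `M` (`maninData_of_item`), and `H → M → P` is the landed Murty–Zagier
calibration `Summit.ABC.ABC.Theorems.polyDegree_of_polyHeight_of_manin` (p102896). EXACTNESS, hypothesis-free
(`polyDegreeOfBoundedPrimes_iff_items`): `B ↔ (B' ∧ (A → SMB2))` — crux B is the conjunction of the sibling crux
B' and of "crux A ⟹ the known-in-print support item"; nothing of B is lost or added by the reshape. The v6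
route through the optimal curve is kept as `PolyDegreeOfBoundedPrimes_of_mazurKenku` (ED now a theorem, CES a
hypothesis, `hMK` the item) for continuity.

Standing negatives (cdisprove `Disproof.lean` v4, 2026-08-16T05:36Z; `Negative/AbstractStrengtheningFalse` p82575,
`Negative/ExponentBelowThreeHalves` p82674): unchanged since cycle 2, no `-- Targets` theorem touches `H`, B' or
SMB2; v7 asserts no output exponent and nothing abstract about prime sizes; A is used (it supplies the datum that
SMB2 consumes and feeds B').

## Registered stubs of v7

* `stub_polyHeightOfBoundedPrimes : PolyHeightOfBoundedPrimes` — OPEN; = item stmt-ABC-16006 (conjecture-grade: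
  A ⟹ polynomial Szpiro, height form, semistable). The only `sorry` of this file.

Closed / absorbed v6 stubs: `stub_edixhovenFact` CLOSED (tree theorem, kept below without `sorry`);
`stub_cesnaviciusFact` ABSORBED into `hMan` (not restated); `stub_polyHeight` (`H`) WEAKENED to `A → H` = B'.
-/

noncomputable section

-- `Summit.<Summit>.<Problem>`: for the single-conjunct summit `ABC` the duplicate `ABC.ABC` is mandated.
set_option linter.dupNamespace false

open Literature.NumberTheory.EllipticCurves
open Literature.NumberTheory.EllipticCurves.ModularForms
open Summit.ABC.ABC.Theses.IsogenyGlueCongruence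

namespace Summit.ABC.ABC.Cruxes.PolyDegreeOfBoundedPrimes.Sketch

/-! ## Named statements -/

/-- `P`: the polynomial modular-degree conjecture for semistable curves, `∃ D` idiom — literally the
consequent of the crux (Frey 1989; Pasten–Shimura 2024, Conj. 3.2, restricted to semistable curves). -/
def PolyDegree : Prop :=
  ∃ κ C : ℝ, ∀ (W : WeierstrassCurve ℚ) [W.IsElliptic] [W.IsGloballyMinimal]
    [NeZero (W.conductorNorm ℤ)], W.IsSemistable ℤ →
    ∃ D : ModularParametrizationData W (W.conductorNorm ℤ),
      (D.modularDegree : ℝ) ≤ C * (W.conductorNorm ℤ : ℝ) ^ κ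

/-- `H`: the polynomial HEIGHT conjecture for semistable curves (Frey's height conjecture / polynomial
Szpiro in the `max(|Δ|, |c₄|³)` form, exponent free; Pasten–Shimura 2024, Conj. 3.1 restricted to
semistable curves). Conjecture-grade; the consequent of the sibling crux B'. -/
def PolyHeight : Prop :=
  ∃ σ C : ℝ, ∀ (W : WeierstrassCurve ℚ) [W.IsElliptic] [W.IsGloballyMinimal]
    [NeZero (W.conductorNorm ℤ)], W.IsSemistable ℤ →
    ((max |W.Δ| (|W.c₄| ^ 3) : ℚ) : ℝ) ≤ C * (W.conductorNorm ℤ : ℝ) ^ σ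

/-- `M`: polynomially bounded Manin data for semistable curves (known in print with exponent `0`,
`M₀ = 163`, granted modularity: Edixhoven 1991, Česnavičius 2018, Kenku 1982). -/
def ManinData : Prop :=
  ∃ a M₀ : ℝ, ∀ (W : WeierstrassCurve ℚ) [W.IsElliptic] [W.IsGloballyMinimal]
    [NeZero (W.conductorNorm ℤ)], W.IsSemistable ℤ →
    ∃ D : ModularParametrizationData W (W.conductorNorm ℤ),
      |(D.maninConstant : ℝ)| ≤ M₀ * (W.conductorNorm ℤ : ℝ) ^ a

/-- `hCes`, the universal closure of the tree's named fact
`ModularParametrizationData.abs_maninConstant_eq_one_of_isSemistable` (Česnavičius 2018, Thm. 1.2) — in v7 only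
a hypothesis of the continuity theorem `PolyDegreeOfBoundedPrimes_of_mazurKenku`, no longer a stub. -/
def CesnaviciusFact : Prop :=
  ∀ {W' : WeierstrassCurve ℚ} {N' : ℕ} [NeZero N'] (D' : ModularParametrizationData W' N'),
    D'.abs_maninConstant_eq_one_of_isSemistable

/-! ## Registered stub — the ONLY `sorry` of v7 -/

/-- Stub B' (= the sibling crux `PolyHeightOfBoundedPrimes`, stmt-ABC-16006, BY NAME): granted crux A, the
polynomial height conjecture for semistable curves. Conjecture-grade; OPEN; owned by the leads of stmt-ABC-16006
(line archimedean-hall-split) — this line is blocked on it and does not attack it with workers. -/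
theorem stub_polyHeightOfBoundedPrimes : Summit.ABC.ABC.Theses.IsogenyGlueCongruence.PolyHeightOfBoundedPrimes := by
  sorry

/-! ## v6 stubs now closed (no `sorry` below this line) -/

/-- Stub ED of v6 — CLOSED: Edixhoven 1991, Prop. 2 in lattice form is the tree theorem
`Summit.ABC.ABC.Theorems.edixhovenIntegrality_proof` (verbatim this signature up to the name of the route
item `EdixhovenIntegrality`, stmt-ABC-15990, closed 2026-08-17). Kept under its registered name; lands in
Theorems as `Summit.ABC.ABC.Theorems.stub_edixhovenFact` (p137484). -/
theorem stub_edixhovenFact : ∀ {N : ℕ} [NeZero N] {W' : WeierstrassCurve ℚ} [W'.IsElliptic] [W'.IsGloballyMinimal] {f : CuspForm (CongruenceSubgroup.Gamma0 N) 2} {L' : PeriodPair}, Literature.NumberTheory.EllipticCurves.ModularForms.IsNewformOf W' f → Literature.NumberTheory.EllipticCurves.ModularForms.IsNeronLatticeOf (W'.baseChange ℂ) L' → ∀ q : ℚ, (∀ z ∈ Literature.NumberTheory.EllipticCurves.ModularForms.periodLattice f, (q : ℂ) * z ∈ L'.lattice) → (∀ z ∈ L'.lattice, ∃ w ∈ Literature.NumberTheory.EllipticCurves.ModularForms.periodLattice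 f, z = q * w) → ∃ k : ℤ, (k : ℚ) = q :=
  @Summit.ABC.ABC.Theorems.edixhovenIntegrality_proof

/-! ## Proved glue -/

/-- **`SMB2 → A → M`**: crux A supplies a datum of every semistable globally minimal `W` (its only direct use
in the composition); `N_W` is square-free (`isSemistable_iff_squarefree_conductorNorm`), so the item yields a
datum of `W` at level `N_W` with `|c| ≤ M₀ · N_W^a`. -/
theorem maninData_of_item (hMan : SemistableManinBound2) (hA : DegreePrimesPolyBounded) : ManinData := by
  obtain ⟨a, M₀, h⟩ := hMan
  obtain ⟨κ, C, hA⟩ := hA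
  refine ⟨a, M₀, fun W _ _ _ hss ↦ ?_⟩
  obtain ⟨D, -⟩ := hA W hss
  exact h (W.conductorNorm ℤ) W D ((W.isSemistable_iff_squarefree_conductorNorm).mp hss)

/-- **`M → SMB2`** (Carayol at square-free level, theorems of the tree: a globally minimal `W` with a datum at
a square-free level `N` is semistable with `N = N_W`), so the packaging of the Manin input into the item loses
nothing. -/
theorem semistableManinBound2_of_maninData (hM : ManinData) : SemistableManinBound2 := by
  obtain ⟨a, M₀, h⟩ := hM
  refine ⟨a, M₀, fun N _ W _ _ D hN ↦ ?_⟩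
  have hNW : N = W.conductorNorm ℤ := D.isNewformOf.level_eq_conductorNorm_of_squarefree_level hN
  have hss : W.IsSemistable ℤ := D.isNewformOf.isSemistable_of_squarefree_level hN
  subst hNW
  obtain ⟨D', hD'⟩ := h W hss
  exact ⟨D', hD'⟩

/-- **Granted A, `SMB2 ↔ M`.** -/
theorem semistableManinBound2_iff_maninData (hA : DegreePrimesPolyBounded) :
    SemistableManinBound2 ↔ ManinData :=
  ⟨fun hMan ↦ maninData_of_item hMan hA, semistableManinBound2_of_maninData⟩

/-! ## The composition (kernel-checked; concludes the crux BY NAME) -/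

/-- **`PolyDegreeOfBoundedPrimes_of`** — the line, v7: the only hypothesis is the route's known-in-print support
item `SemistableManinBound2` (stmt-ABC-16014); the only stub is the sibling crux B' (stmt-ABC-16006); the rest is
the landed Murty–Zagier calibration `H → M → P` (`polyDegree_of_polyHeight_of_manin`, p102896: Zagier's identity,
Petersson upper bound at square-free level, Silverman's covolume inequality — theorems of the tree). -/
theorem PolyDegreeOfBoundedPrimes_of (hMan : SemistableManinBound2) : PolyDegreeOfBoundedPrimes :=
  fun hA ↦ Summit.ABC.ABC.Theorems.polyDegree_of_polyHeight_of_manin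
    (stub_polyHeightOfBoundedPrimes hA) (maninData_of_item hMan hA)

/-! ## Exactness of v7: crux B IS crux B' plus "A ⟹ the support item" -/

/-- **`B ↔ (B' ∧ (A → SMB2))`, hypothesis-free** (`→`: `polyHeight_of_polyDegreeOfBoundedPrimes` and
`manin_of_polyDegree`, p102896/p104128, then Carayol; `←`: the glue). Lands as
`Summit.ABC.ABC.Theorems.polyDegreeOfBoundedPrimes_iff_polyHeightOfBoundedPrimes_and_semistableManinBound2`
(registered sub-goal, p137484). -/
theorem polyDegreeOfBoundedPrimes_iff_items :
    PolyDegreeOfBoundedPrimes ↔ (PolyHeightOfBoundedPrimes ∧ (DegreePrimesPolyBounded → SemistableManinBound2)) :=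
  ⟨fun hB ↦ ⟨fun hA ↦ Summit.ABC.ABC.Theorems.polyHeight_of_polyDegreeOfBoundedPrimes hB hA,
      fun hA ↦ semistableManinBound2_of_maninData (Summit.ABC.ABC.Theorems.manin_of_polyDegree (hB hA))⟩,
    fun h hA ↦ Summit.ABC.ABC.Theorems.polyDegree_of_polyHeight_of_manin (h.1 hA) (maninData_of_item (h.2 hA) hA)⟩

/-- **`SMB2 → (B ↔ B')`**: modulo the known-in-print item, crux B is the sibling crux B'. -/
theorem polyDegreeOfBoundedPrimes_iff (hMan : SemistableManinBound2) :
    PolyDegreeOfBoundedPrimes ↔ PolyHeightOfBoundedPrimes :=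
  ⟨fun hB ↦ (polyDegreeOfBoundedPrimes_iff_items.mp hB).1,
    fun hB' ↦ polyDegreeOfBoundedPrimes_iff_items.mpr ⟨hB', fun _ ↦ hMan⟩⟩

/-- **`P ↔ H` modulo SMB2 and modularity** (`ModularDatumExists`, stmt-ABC-15126): the consequent of the crux is
the polynomial height conjecture for semistable curves. -/
theorem polyDegree_iff_polyHeight (hMan : SemistableManinBound2) (hMod : ModularDatumExists) :
    PolyDegree ↔ PolyHeight := by
  refine ⟨Summit.ABC.ABC.Theorems.polyHeight_of_polyDegree, fun hH ↦ ?_⟩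
  obtain ⟨a, M₀, h⟩ := hMan
  refine Summit.ABC.ABC.Theorems.polyDegree_of_polyHeight_of_manin hH ⟨a, M₀, fun W _ _ _ hss ↦ ?_⟩
  obtain ⟨D⟩ := hMod W
  exact h (W.conductorNorm ℤ) W D ((W.isSemistable_iff_squarefree_conductorNorm).mp hss)

/-! ## Continuity with v6: the optimal-curve route, Edixhoven now discharged -/

/-- **The v6 composition with ED closed**: `CES → MazurKenkuBound → B` over the stub B' — the cycle-5 item-form
bridge `polyDegreeOfBoundedPrimes_of_polyHeight_of_items` (p116449) fed with the tree theorem for ED. It shows what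
the item hypothesis `hMan` of v7 replaces: Česnavičius + Mazur–Kenku (+ Edixhoven, now free). -/
theorem PolyDegreeOfBoundedPrimes_of_mazurKenku (hCes : CesnaviciusFact) (hMK : MazurKenkuBound) :
    PolyDegreeOfBoundedPrimes :=
  fun hA ↦ Summit.ABC.ABC.Theorems.polyDegreeOfBoundedPrimes_of_polyHeight_of_items stub_edixhovenFact hCes hMK
    (stub_polyHeightOfBoundedPrimes hA) hA

end Summit.ABC.ABC.Cruxes.PolyDegreeOfBoundedPrimes.Sketch

end
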